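import Mathlib.Analysis.Calculus.MeanValue
import Mathlib.Analysis.Calculus.ContDiff.Basic
import Literature.Analysis.FunctionSpaces.ContDiffHolderAlgebra
import Literature.Analysis.FunctionSpaces.ContDiffHolderLeibniz
import HarnessLib

/-!
# Interpolation inequalities for the `C^{k,α}` norms (Euclidean space and the flat torus)

Analysis/FunctionSpaces support file (everything proved). For the accepted scale of norms
`eContDiffHolderNorm k r f = ∑_{j ≤ k} ‖Dʲf‖_∞ + [Dᵏf]_r` (`HolderNorm.lean`) and its torus version
`Torus.eContDiffHolderNorm`, we prove the classical interpolation ("log-convexity") inequalities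
of Hölder norms (Buckmaster–De Lellis–Székelyhidi–Vicol 2019, App. A, (A.1) and (A.4):
"`[f]_s ≤ C(ε^{r-s}[f]_r + ε^{-s}‖f‖₀)` … from which we obtain the standard interpolation
inequalities `[f]_s ≤ C‖f‖₀^{1-s/r}[f]_r^{s/r}`"; Gilbarg–Trudinger 2001, (6.8)–(6.9) and
Lemma 6.35; Hörmander 1976, Thm. A.5), in the rational-exponent-free product form in which they
are consumed by tame (Moser-type) estimates:

* `eSupNorm_fderiv_le_of_scale`, `eHolderNorm_fderiv_le_of_scale` — the **scale-`h`
  inequalities** `‖Df‖_∞ ≤ (2/h)‖f‖_∞ + h‖D²f‖_∞` and `[Df]_r ≤ (2/h)[f]_r + h[D²f]_r` for `C²` maps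
  on a real normed space and every `h > 0` (Taylor expansion along segments; (A.1) at scale `h`);
* `sq_eContDiffHolderNorm_succ_le` — **three consecutive orders**:
  `‖f‖_{k+1,r}² ≤ 4^{k+3} ‖f‖_{k,r} ‖f‖_{k+2,r}` (optimising `h`; induction on `k` through
  `‖f‖_{k+1,r} = ‖f‖_∞ + ‖Df‖_{k,r}`);
* `Torus.eContDiffHolderNorm_mul_le_of_add_eq` — the **tame product inequality** on `T^d`:
  for smooth `f`, `r ≤ 1` and orders `k ≤ p`, `q ≤ m` with `p + q = k + m`,
  `‖f‖_{p,r} ‖f‖_{q,r} ≤ C(m) ‖f‖_{k,r} ‖f‖_{m,r}` (discrete log-convexity), and its corollary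
  `Torus.eContDiffHolderNorm_mul_le_tame`: `‖f‖_{p,r}‖f‖_{q,r} ≤ C ‖f‖_{1,r}‖f‖_{m,r}` for
  `p, q ≥ 1`, `p + q = m + 1`, the form used for the commutator and pressure terms of the Euler equations (BDSV 2019, proof
  of Prop. 3.1: "`‖∇v·∇v‖_{N-1+α} ≲ ‖v‖_{1+α}‖v‖_{N+α}`").

Constants are explicit and crude (powers of `4`); only their independence of `f` matters.

## Mathlib / tree search

Mathlib has `eHolderNorm`, `HolderWith`, the mean value inequalities
(`norm_image_sub_le_of_norm_deriv_le_segment'`, `Convex.norm_image_sub_le_of_norm_fderiv_le`) but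
no interpolation inequalities between derivatives (`lean search 'interpolation|Landau|Kolmogorov'`
in `Analysis/Calculus`: nothing). Tree: `holderWith_of_lipschitzWith_of_edist_le`
(`HolderInterpolation.lean`, interpolation between a Lipschitz and an oscillation bound, i.e. the
case `s < 1 = r` of (A.1)) and `eContDiffHolderNorm_le_three_mul_succ` (comparison of consecutive
orders); the inequalities between three orders proved here are new.

## References

* T. Buckmaster, C. De Lellis, L. Székelyhidi Jr., V. Vicol, *Onsager's conjecture for admissible
  weak solutions*, Comm. Pure Appl. Math. 72 (2019) 229–274 = arXiv:1701.08678, App. A,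
  (A.1)–(A.4). [`BuckmasterEtAl2018`]
* D. Gilbarg, N. S. Trudinger, *Elliptic Partial Differential Equations of Second Order* (2001),
  (6.8)–(6.9), Lemma 6.35 (interpolation inequalities). [`GilbargTrudinger2001`]
-/

noncomputable section

open Set Filter Function
open scoped NNReal ENNReal Topology

namespace Literature.Analysis.FunctionSpaces

universe u

/-! ## Scale-`h` inequalities on a real normed space -/

section Scale

variable {E' Y : Type*} [NormedAddCommGroup E'] [NormedSpace ℝ E'] [NormedAddCommGroup Y]
  [NormedSpace ℝ Y]

/-- **Taylor at scale `h`, pointwise.** For a `C²` map with `‖f‖ ≤ M₀` and `‖D²f‖ ≤ M₂`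
everywhere, `h ‖Df(x) v‖ ≤ 2 M₀ + h² M₂` for `‖v‖ ≤ 1`, `h > 0`: along the segment
`s ↦ x + s v` one has `f(x + hv) - f(x) - h Df(x)v = ∫₀ʰ (Df(x+sv) - Df(x)) v ds` and
`‖Df(x+sv) - Df(x)‖ ≤ M₂ s` (mean value inequality, twice) (Gilbarg–Trudinger (6.8) at scale `h`;
BDSV (A.1)). [folklore] -/
theorem mul_norm_fderiv_apply_le_of_bounds {f : E' → Y} (hf : ContDiff ℝ 2 f) {M₀ M₂ : ℝ}
    (h0 : ∀ a, ‖f a‖ ≤ M₀) (h2 : ∀ a, ‖fderiv ℝ (fderiv ℝ f) a‖ ≤ M₂) (x v : E') (hv : ‖v‖ ≤ 1)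
    {h : ℝ} (hh : 0 < h) : h * ‖fderiv ℝ f x v‖ ≤ 2 * M₀ + h ^ 2 * M₂ := by
  have hM₂ : 0 ≤ M₂ := le_trans (norm_nonneg (fderiv ℝ (fderiv ℝ f) x)) (h2 x)
  have hd : Differentiable ℝ f := hf.differentiable (by simp)
  have hDd : Differentiable ℝ (fderiv ℝ f) :=
    (hf.fderiv_right (m := 1) (by norm_num)).differentiable (by simp)
  -- the path `ψ(s) = f(x + s v) - s • Df(x) v` and its derivative
  set ψ : ℝ → Y := fun s => f (x + s • v) - s • fderiv ℝ f x v with hψ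
  have hderiv : ∀ s : ℝ, HasDerivAt ψ (fderiv ℝ f (x + s • v) v - fderiv ℝ f x v) s := by
    intro s
    have hγ : HasDerivAt (fun σ : ℝ => x + σ • v) v s := by
      simpa using ((hasDerivAt_id s).smul_const v).const_add x
    have h1 : HasDerivAt (fun σ : ℝ => f (x + σ • v)) (fderiv ℝ f (x + s • v) v) s :=
      (hd (x + s • v)).hasFDerivAt.comp_hasDerivAt s hγ
    have h2' : HasDerivAt (fun σ : ℝ => σ • fderiv ℝ f x v) (fderiv ℝ f x v) s := by
      simpa using (hasDerivAt_id s).smul_const (fderiv ℝ f x v)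
    exact h1.sub h2'
  -- bound on the derivative of `ψ` on `[0, h]`
  have hbound : ∀ s ∈ Ico (0 : ℝ) h, ‖fderiv ℝ f (x + s • v) v - fderiv ℝ f x v‖ ≤ M₂ * h := by
    intro s hs
    have hincr : ‖fderiv ℝ f (x + s • v) - fderiv ℝ f x‖ ≤ M₂ * ‖x + s • v - x‖ :=
      (convex_univ).norm_image_sub_le_of_norm_fderiv_le (fun z _ => (hDd z))
        (fun z _ => h2 z) (mem_univ x) (mem_univ (x + s • v))
    have hsv : ‖x + s • v - x‖ ≤ h := by
      rw [add_sub_cancel_left, norm_smul, Real.norm_eq_abs, abs_of_nonneg hs.1]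
      calc s * ‖v‖ ≤ h * 1 := mul_le_mul hs.2.le hv (norm_nonneg _) hh.le
        _ = h := mul_one h
    calc ‖fderiv ℝ f (x + s • v) v - fderiv ℝ f x v‖
        = ‖(fderiv ℝ f (x + s • v) - fderiv ℝ f x) v‖ := rfl
      _ ≤ ‖fderiv ℝ f (x + s • v) - fderiv ℝ f x‖ * ‖v‖ := ContinuousLinearMap.le_opNorm _ _
      _ ≤ M₂ * ‖x + s • v - x‖ * 1 := mul_le_mul hincr hv (norm_nonneg _) (by positivity)
      _ ≤ M₂ * h := by rw [mul_one]; exact mul_le_mul_of_nonneg_left hsv hM₂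
  have hmv := norm_image_sub_le_of_norm_deriv_le_segment' (f := ψ) (a := 0) (b := h)
    (fun s _ => (hderiv s).hasDerivWithinAt) hbound h (right_mem_Icc.2 hh.le)
  have hψh : ψ h - ψ 0 = f (x + h • v) - f x - h • fderiv ℝ f x v := by
    simp only [hψ, zero_smul, add_zero, sub_zero]
    abel
  rw [hψh, sub_zero] at hmv
  -- `h ‖Df(x)v‖ ≤ ‖f(x+hv)‖ + ‖f x‖ + M₂ h²`
  have htri : ‖h • fderiv ℝ f x v‖ ≤ ‖f (x + h • v)‖ + ‖f x‖ + M₂ * h * h := by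
    have e : h • fderiv ℝ f x v = f (x + h • v) - f x - (f (x + h • v) - f x - h • fderiv ℝ f x v) := by
      abel
    rw [e]
    refine (norm_sub_le _ _).trans (add_le_add (norm_sub_le _ _) hmv)
  rw [norm_smul, Real.norm_eq_abs, abs_of_pos hh] at htri
  calc h * ‖fderiv ℝ f x v‖ ≤ ‖f (x + h • v)‖ + ‖f x‖ + M₂ * h * h := htri
    _ ≤ M₀ + M₀ + M₂ * h * h := by gcongr <;> exact h0 _
    _ = 2 * M₀ + h ^ 2 * M₂ := by ring

/-- **Scale-`h` bound for the derivative, pointwise operator form**: under the hypotheses of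
`mul_norm_fderiv_apply_le_of_bounds`, `‖Df(x)‖ ≤ 2M₀/h + h M₂`. [folklore] -/
theorem norm_fderiv_le_of_bounds {f : E' → Y} (hf : ContDiff ℝ 2 f) {M₀ M₂ : ℝ}
    (h0 : ∀ a, ‖f a‖ ≤ M₀) (h2 : ∀ a, ‖fderiv ℝ (fderiv ℝ f) a‖ ≤ M₂) (x : E') {h : ℝ}
    (hh : 0 < h) : ‖fderiv ℝ f x‖ ≤ 2 / h * M₀ + h * M₂ := by
  have hM₀ : 0 ≤ M₀ := le_trans (norm_nonneg (f x)) (h0 x)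
  have hM₂ : 0 ≤ M₂ := le_trans (norm_nonneg (fderiv ℝ (fderiv ℝ f) x)) (h2 x)
  refine ContinuousLinearMap.opNorm_le_bound _ (by positivity) fun v => ?_
  rcases eq_or_ne v 0 with rfl | hv
  · simp
  -- normalise `v`
  have hvn : 0 < ‖v‖ := norm_pos_iff.2 hv
  set w : E' := ‖v‖⁻¹ • v with hw
  have hw1 : ‖w‖ ≤ 1 := by
    rw [hw, norm_smul, norm_inv, norm_norm, inv_mul_cancel₀ hvn.ne']
  have key := mul_norm_fderiv_apply_le_of_bounds hf h0 h2 x w hw1 hh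
  have hvw : v = ‖v‖ • w := by
    rw [hw, smul_smul, mul_inv_cancel₀ hvn.ne', one_smul]
  have e : ‖fderiv ℝ f x v‖ = ‖v‖ * ‖fderiv ℝ f x w‖ := by
    conv_lhs => rw [hvw]
    rw [ContinuousLinearMap.map_smul, norm_smul, norm_norm]
  rw [e, mul_comm]
  refine mul_le_mul_of_nonneg_right ?_ (norm_nonneg _)
  have hdiv : ‖fderiv ℝ f x w‖ ≤ (2 * M₀ + h ^ 2 * M₂) / h := by
    rw [le_div_iff₀ hh, mul_comm]
    exact key
  refine hdiv.trans_eq ?_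
  field_simp

/-- **Scale-`h` inequality for the sup norm of the derivative** (Landau–Kolmogorov form of BDSV
(A.1)): `‖Df‖_∞ ≤ (2/h) ‖f‖_∞ + h ‖D²f‖_∞` for `C²` maps and every `h > 0` (extended norms; both
sides may be infinite). [folklore] -/
theorem eSupNorm_fderiv_le_of_scale {f : E' → Y} (hf : ContDiff ℝ 2 f) {h : ℝ} (hh : 0 < h) :
    eSupNorm (fderiv ℝ f) ≤ ENNReal.ofReal (2 / h) * eSupNorm f +
      ENNReal.ofReal h * eSupNorm (fderiv ℝ (fderiv ℝ f)) := by
  by_cases h0 : eSupNorm f = ⊤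
  · rw [h0, ENNReal.mul_top (ENNReal.ofReal_ne_zero_iff.mpr (by positivity)), top_add]
    exact le_top
  by_cases h2 : eSupNorm (fderiv ℝ (fderiv ℝ f)) = ⊤
  · rw [h2, ENNReal.mul_top (ENNReal.ofReal_ne_zero_iff.mpr hh), add_top]
    exact le_top
  have hb0 : ∀ a, ‖f a‖ ≤ (eSupNorm f).toReal := fun a => by
    rw [← ENNReal.ofReal_le_iff_le_toReal h0, ofReal_norm]
    exact enorm_le_eSupNorm f a
  have hb2 : ∀ a, ‖fderiv ℝ (fderiv ℝ f) a‖ ≤ (eSupNorm (fderiv ℝ (fderiv ℝ f))).toReal :=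
    fun a => (ENNReal.ofReal_le_iff_le_toReal h2).1
      ((ofReal_norm _).trans_le (enorm_le_eSupNorm _ a))
  refine iSup_le fun x => ?_
  have key := norm_fderiv_le_of_bounds hf hb0 hb2 x hh
  calc ‖fderiv ℝ f x‖ₑ = ENNReal.ofReal ‖fderiv ℝ f x‖ := (ofReal_norm _).symm
    _ ≤ ENNReal.ofReal (2 / h * (eSupNorm f).toReal +
          h * (eSupNorm (fderiv ℝ (fderiv ℝ f))).toReal) := ENNReal.ofReal_le_ofReal key
    _ = ENNReal.ofReal (2 / h) * eSupNorm f +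
          ENNReal.ofReal h * eSupNorm (fderiv ℝ (fderiv ℝ f)) := by
        rw [ENNReal.ofReal_add (by positivity) (by positivity),
          ENNReal.ofReal_mul (by positivity), ENNReal.ofReal_mul hh.le,
          ENNReal.ofReal_toReal h0, ENNReal.ofReal_toReal h2]

omit [NormedSpace ℝ E'] [NormedSpace ℝ Y] in
/-- A real Hölder bound from a finite extended Hölder seminorm:
`‖f a - f b‖ ≤ [f]_r ‖a - b‖^r` with `[f]_r = (eHolderNorm r f).toReal`. [folklore] -/
theorem norm_sub_le_toReal_eHolderNorm_mul {f : E' → Y} {r : ℝ≥0} (hf : eHolderNorm r f ≠ ⊤)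
    (a b : E') : ‖f a - f b‖ ≤ (eHolderNorm r f).toReal * ‖a - b‖ ^ (r : ℝ) := by
  have hmem : MemHolder r f := eHolderNorm_lt_top.1 (lt_top_iff_ne_top.2 hf)
  have h := hmem.holderWith.dist_le (x := a) (y := b)
  rw [dist_eq_norm, dist_eq_norm] at h
  rwa [← hmem.coe_nnHolderNorm_eq_eHolderNorm, ENNReal.coe_toReal]

/-- **Scale-`h` inequality for the Hölder seminorm of the derivative** (BDSV (A.1) between the
orders `r`, `1 + r`, `2 + r`): `[Df]_r ≤ (2/h) [f]_r + h [D²f]_r` for `C²` maps and every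
`h > 0`. Proof: the sup-norm inequality applied to `z ↦ f(z) - f(z - w)`, `w = x - y`, whose sup
norm is at most `[f]_r ‖w‖^r` and whose second derivative has sup norm at most `[D²f]_r ‖w‖^r`.
[folklore] -/
theorem eHolderNorm_fderiv_le_of_scale {f : E' → Y} (hf : ContDiff ℝ 2 f) (r : ℝ≥0) {h : ℝ}
    (hh : 0 < h) :
    eHolderNorm r (fderiv ℝ f) ≤ ENNReal.ofReal (2 / h) * eHolderNorm r f +
      ENNReal.ofReal h * eHolderNorm r (fderiv ℝ (fderiv ℝ f)) := by
  by_cases h0 : eHolderNorm r f = ⊤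
  · rw [h0, ENNReal.mul_top (ENNReal.ofReal_ne_zero_iff.mpr (by positivity)), top_add]
    exact le_top
  by_cases h2 : eHolderNorm r (fderiv ℝ (fderiv ℝ f)) = ⊤
  · rw [h2, ENNReal.mul_top (ENNReal.ofReal_ne_zero_iff.mpr hh), add_top]
    exact le_top
  set H₀ := (eHolderNorm r f).toReal with hH₀
  set H₂ := (eHolderNorm r (fderiv ℝ (fderiv ℝ f))).toReal with hH₂
  have hd : Differentiable ℝ f := hf.differentiable (by simp)
  have hDf : ContDiff ℝ 1 (fderiv ℝ f) := hf.fderiv_right (m := 1) (by norm_num)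
  have hDd : Differentiable ℝ (fderiv ℝ f) := hDf.differentiable (by simp)
  refine eHolderNorm_le_of_forall_edist_le fun x y => ?_
  -- the translated difference `F z = f z - f (z - w)`, `w = x - y`
  set w : E' := x - y with hw
  set F : E' → Y := fun z => f z - f (z + -w) with hF
  have hFc : ContDiff ℝ 2 F := hf.sub (hf.comp (contDiff_id.add contDiff_const))
  have hDF : fderiv ℝ F = fun z => fderiv ℝ f z - fderiv ℝ f (z + -w) := by
    funext z
    have h1 : DifferentiableAt ℝ (fun z => f (z + -w)) z :=
      (differentiableAt_comp_add_right (-w)).2 (hd _)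
    rw [hF, fderiv_fun_sub (hd z) h1, fderiv_comp_add_right]
  have hDDF : fderiv ℝ (fderiv ℝ F) = fun z =>
      fderiv ℝ (fderiv ℝ f) z - fderiv ℝ (fderiv ℝ f) (z + -w) := by
    rw [hDF]
    funext z
    have h1 : DifferentiableAt ℝ (fun z => fderiv ℝ f (z + -w)) z :=
      (differentiableAt_comp_add_right (-w)).2 (hDd _)
    rw [fderiv_fun_sub (hDd z) h1, fderiv_comp_add_right]
  -- the two sup bounds for `F`
  have hb0 : ∀ a, ‖F a‖ ≤ H₀ * ‖w‖ ^ (r : ℝ) := fun a => by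
    have := norm_sub_le_toReal_eHolderNorm_mul h0 a (a + -w)
    rwa [show a - (a + -w) = w by abel] at this
  have hb2 : ∀ a, ‖fderiv ℝ (fderiv ℝ F) a‖ ≤ H₂ * ‖w‖ ^ (r : ℝ) := fun a => by
    rw [hDDF]
    have := norm_sub_le_toReal_eHolderNorm_mul h2 a (a + -w)
    rwa [show a - (a + -w) = w by abel] at this
  have key := norm_fderiv_le_of_bounds hFc hb0 hb2 x hh
  have hFx : fderiv ℝ F x = fderiv ℝ f x - fderiv ℝ f y := by
    rw [hDF]
    simp [hw]
  rw [hFx] at key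
  -- conversion to `edist`
  have hwr : ENNReal.ofReal (‖w‖ ^ (r : ℝ)) = edist x y ^ (r : ℝ) := by
    rw [← ENNReal.ofReal_rpow_of_nonneg (norm_nonneg w) (NNReal.coe_nonneg r), ofReal_norm, hw,
      edist_eq_enorm_sub]
  calc edist (fderiv ℝ f x) (fderiv ℝ f y)
      = ENNReal.ofReal ‖fderiv ℝ f x - fderiv ℝ f y‖ := by rw [edist_eq_enorm_sub, ofReal_norm]
    _ ≤ ENNReal.ofReal (2 / h * (H₀ * ‖w‖ ^ (r : ℝ)) + h * (H₂ * ‖w‖ ^ (r : ℝ))) :=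
        ENNReal.ofReal_le_ofReal key
    _ = (ENNReal.ofReal (2 / h) * eHolderNorm r f +
          ENNReal.ofReal h * eHolderNorm r (fderiv ℝ (fderiv ℝ f))) * edist x y ^ (r : ℝ) := by
        rw [← mul_assoc, ← mul_assoc, ← add_mul, ENNReal.ofReal_mul (by positivity), ← hwr,
          ENNReal.ofReal_add (by positivity) (by positivity), ENNReal.ofReal_mul (by positivity),
          ENNReal.ofReal_mul hh.le, hH₀, hH₂, ENNReal.ofReal_toReal h0, ENNReal.ofReal_toReal h2]

end Scale

/-! ## Optimising the scale: three consecutive orders -/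

section Optimise

/-- **Optimising a scale inequality (real form)**: if `t ≤ (2/s) x + s y` for all `s > 0`, with
`t, x, y ≥ 0`, then `t² ≤ 8 x y` (take `s = 4x/t`). [folklore] -/
theorem sq_le_eight_mul_of_forall_scale_real {t x y : ℝ} (ht : 0 ≤ t) (hx : 0 ≤ x) (hy : 0 ≤ y)
    (h : ∀ s : ℝ, 0 < s → t ≤ 2 / s * x + s * y) : t ^ 2 ≤ 8 * x * y := by
  rcases ht.eq_or_lt with rfl | ht0
  · simpa using mul_nonneg (mul_nonneg (by norm_num : (0 : ℝ) ≤ 8) hx) hy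
  rcases hx.eq_or_lt with rfl | hx0
  · -- `x = 0`: `t ≤ s y` for all `s > 0` contradicts `t > 0`
    exfalso
    have hs : 0 < t / (2 * (y + 1)) := by positivity
    have h1 := h _ hs
    rw [mul_zero, zero_add] at h1
    have h2 : t / (2 * (y + 1)) * y ≤ t / 2 := by
      rw [div_mul_eq_mul_div, div_le_div_iff₀ (by positivity) (by norm_num)]
      nlinarith
    linarith
  · have hs : 0 < 4 * x / t := by positivity
    have h1 := h _ hs
    have e1 : 2 / (4 * x / t) * x = t / 2 := by
      field_simp
      ring
    rw [e1] at h1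
    have e2 : t / 2 ≤ 4 * x / t * y := by linarith
    rw [div_mul_eq_mul_div, le_div_iff₀ ht0] at e2
    nlinarith

/-- **Optimising a scale inequality** (`ℝ≥0∞` form): if `T ≤ (2/s) X + s Y` for all real `s > 0`
and `X, Y` are finite, then `T² ≤ 8 X Y`. (Finiteness is needed: for `X = 0`, `Y = ∞` the
hypothesis is void.) [folklore] -/
theorem sq_le_of_forall_scale {T X Y : ℝ≥0∞} (hX : X ≠ ⊤) (hY : Y ≠ ⊤)
    (h : ∀ s : ℝ, 0 < s → T ≤ ENNReal.ofReal (2 / s) * X + ENNReal.ofReal s * Y) :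
    T ^ 2 ≤ 8 * X * Y := by
  have hfin : ∀ s : ℝ, ENNReal.ofReal (2 / s) * X + ENNReal.ofReal s * Y ≠ ⊤ := fun s =>
    ENNReal.add_ne_top.2 ⟨ENNReal.mul_ne_top ENNReal.ofReal_ne_top hX,
      ENNReal.mul_ne_top ENNReal.ofReal_ne_top hY⟩
  have hT : T ≠ ⊤ := ne_top_of_le_ne_top (hfin 1) (h 1 one_pos)
  have hreal : ∀ s : ℝ, 0 < s → T.toReal ≤ 2 / s * X.toReal + s * Y.toReal := by
    intro s hs
    have h1 := ENNReal.toReal_mono (hfin s) (h s hs)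
    rwa [ENNReal.toReal_add (ENNReal.mul_ne_top ENNReal.ofReal_ne_top hX)
      (ENNReal.mul_ne_top ENNReal.ofReal_ne_top hY), ENNReal.toReal_mul, ENNReal.toReal_mul,
      ENNReal.toReal_ofReal (by positivity), ENNReal.toReal_ofReal hs.le] at h1
  have key := sq_le_eight_mul_of_forall_scale_real ENNReal.toReal_nonneg ENNReal.toReal_nonneg
    ENNReal.toReal_nonneg hreal
  calc T ^ 2 = ENNReal.ofReal (T.toReal ^ 2) := by
        rw [ENNReal.ofReal_pow ENNReal.toReal_nonneg, ENNReal.ofReal_toReal hT]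
    _ ≤ ENNReal.ofReal (8 * X.toReal * Y.toReal) := ENNReal.ofReal_le_ofReal key
    _ = 8 * X * Y := by
        rw [ENNReal.ofReal_mul (by positivity), ENNReal.ofReal_mul (by norm_num),
          ENNReal.ofReal_toReal hX, ENNReal.ofReal_toReal hY, ENNReal.ofReal_ofNat]

/-- An element below both `A` and `B` is below `(2/s) A + s B` for every `s > 0` (one of the two
coefficients is `≥ 1`). [folklore] -/
theorem le_scale_of_le_of_le {a A B : ℝ≥0∞} (hA : a ≤ A) (hB : a ≤ B) {s : ℝ} (hs : 0 < s) :
    a ≤ ENNReal.ofReal (2 / s) * A + ENNReal.ofReal s * B := by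
  rcases le_or_gt s 2 with h2 | h2
  · have h1 : (1 : ℝ≥0∞) ≤ ENNReal.ofReal (2 / s) := by
      rw [← ENNReal.ofReal_one]
      exact ENNReal.ofReal_le_ofReal ((one_le_div hs).2 h2)
    calc a ≤ A := hA
      _ = 1 * A := (one_mul A).symm
      _ ≤ ENNReal.ofReal (2 / s) * A := mul_le_mul' h1 le_rfl
      _ ≤ _ := le_self_add
  · have h1 : (1 : ℝ≥0∞) ≤ ENNReal.ofReal s := by
      rw [← ENNReal.ofReal_one]
      exact ENNReal.ofReal_le_ofReal (by linarith)
    calc a ≤ B := hB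
      _ = 1 * B := (one_mul B).symm
      _ ≤ ENNReal.ofReal s * B := mul_le_mul' h1 le_rfl
      _ ≤ _ := le_add_self

end Optimise

section ThreeOrders

variable {E' Y : Type u} [NormedAddCommGroup E'] [NormedSpace ℝ E'] [NormedAddCommGroup Y]
  [NormedSpace ℝ Y]

/-- **Three consecutive orders, scale form.** For a `C^{k+2}` map on a real normed space and
every `s > 0`,
`‖f‖_{k+1,r} ≤ (2/s) (k+3) ‖f‖_{k,r} + s (k+3) ‖f‖_{k+2,r}`
(BDSV (A.1) for the orders `k + r < k + 1 + r < k + 2 + r`). Proof by induction on `k` through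
`‖f‖_{k+1,r} = ‖f‖_∞ + ‖Df‖_{k,r}`; the base case is the two scale-`s` inequalities for `‖Df‖_∞`
and `[Df]_r` plus `‖f‖_∞ ≤ (2/s)‖f‖_{0,r} + s‖f‖_{2,r}`. [folklore] -/
theorem eContDiffHolderNorm_succ_le_scale (k : ℕ) {f : E' → Y} (hf : ContDiff ℝ (k + 2) f)
    (r : ℝ≥0) {s : ℝ} (hs : 0 < s) :
    eContDiffHolderNorm (k + 1) r f ≤
      ENNReal.ofReal (2 / s) * ((k + 3 : ℝ≥0∞) * eContDiffHolderNorm k r f) +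
        ENNReal.ofReal s * ((k + 3 : ℝ≥0∞) * eContDiffHolderNorm (k + 2) r f) := by
  induction k generalizing Y with
  | zero =>
    -- notation
    set a := ENNReal.ofReal (2 / s) with ha
    set b := ENNReal.ofReal s with hb
    set A0 := eContDiffHolderNorm 0 r f with hA0
    set A2 := eContDiffHolderNorm 2 r f with hA2
    have hf2 : ContDiff ℝ 2 f := hf
    -- the pieces of `A0`, `A1`, `A2`
    have e0 : A0 = eSupNorm f + eHolderNorm r f := eContDiffHolderNorm_zero_eq r f
    have e1 : eContDiffHolderNorm (0 + 1) r f =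
        eSupNorm f + (eSupNorm (fderiv ℝ f) + eHolderNorm r (fderiv ℝ f)) := by
      rw [eContDiffHolderNorm_succ_eq_fderiv, eContDiffHolderNorm_zero_eq]
    have e2 : A2 = eSupNorm f + (eSupNorm (fderiv ℝ f) +
        (eSupNorm (fderiv ℝ (fderiv ℝ f)) + eHolderNorm r (fderiv ℝ (fderiv ℝ f)))) := by
      rw [hA2, eContDiffHolderNorm_succ_eq_fderiv, eContDiffHolderNorm_succ_eq_fderiv,
        eContDiffHolderNorm_zero_eq]
    -- the three bounds
    have h1 : eSupNorm f ≤ a * A0 + b * A2 :=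
      le_scale_of_le_of_le (by rw [e0]; exact le_self_add) (by rw [e2]; exact le_self_add) hs
    have h2 : eSupNorm (fderiv ℝ f) ≤ a * A0 + b * A2 := by
      refine (eSupNorm_fderiv_le_of_scale hf2 hs).trans (add_le_add ?_ ?_)
      · exact mul_le_mul' le_rfl (by rw [e0]; exact le_self_add)
      · refine mul_le_mul' le_rfl ?_
        rw [e2]
        exact le_trans le_self_add (le_trans le_add_self le_add_self)
    have h3 : eHolderNorm r (fderiv ℝ f) ≤ a * A0 + b * A2 := by
      refine (eHolderNorm_fderiv_le_of_scale hf2 r hs).trans (add_le_add ?_ ?_)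
      · exact mul_le_mul' le_rfl (by rw [e0]; exact le_add_self)
      · refine mul_le_mul' le_rfl ?_
        rw [e2]
        exact le_trans le_add_self (le_trans le_add_self le_add_self)
    rw [e1]
    calc eSupNorm f + (eSupNorm (fderiv ℝ f) + eHolderNorm r (fderiv ℝ f))
        ≤ (a * A0 + b * A2) + ((a * A0 + b * A2) + (a * A0 + b * A2)) :=
          add_le_add h1 (add_le_add h2 h3)
      _ = a * ((↑(0 : ℕ) + 3 : ℝ≥0∞) * A0) + b * ((↑(0 : ℕ) + 3 : ℝ≥0∞) * A2) := by
          push_cast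
          ring
  | succ k IH =>
    set a := ENNReal.ofReal (2 / s) with ha
    set b := ENNReal.ofReal s with hb
    have hDf : ContDiff ℝ (k + 2) (fderiv ℝ f) := hf.fderiv_right (by norm_cast)
    have hIH := IH hDf
    -- `‖f‖_{k+2} = ‖f‖_∞ + ‖Df‖_{k+1}`, `‖Df‖_k ≤ ‖f‖_{k+1}`, `‖Df‖_{k+2} ≤ ‖f‖_{k+3}`
    have hlow : eContDiffHolderNorm k r (fderiv ℝ f) ≤ eContDiffHolderNorm (k + 1) r f :=
      eContDiffHolderNorm_fderiv_le k r f
    have hhigh : eContDiffHolderNorm (k + 2) r (fderiv ℝ f) ≤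
        eContDiffHolderNorm (k + 1 + 2) r f :=
      eContDiffHolderNorm_fderiv_le (k + 2) r f
    have h0 : eSupNorm f ≤ a * eContDiffHolderNorm (k + 1) r f +
        b * eContDiffHolderNorm (k + 1 + 2) r f :=
      le_scale_of_le_of_le (eSupNorm_le_eContDiffHolderNorm _ r f)
        (eSupNorm_le_eContDiffHolderNorm _ r f) hs
    rw [eContDiffHolderNorm_succ_eq_fderiv (k + 1) r f]
    calc eSupNorm f + eContDiffHolderNorm (k + 1) r (fderiv ℝ f)
        ≤ (a * eContDiffHolderNorm (k + 1) r f + b * eContDiffHolderNorm (k + 1 + 2) r f) +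
          (a * ((k + 3 : ℝ≥0∞) * eContDiffHolderNorm k r (fderiv ℝ f)) +
            b * ((k + 3 : ℝ≥0∞) * eContDiffHolderNorm (k + 2) r (fderiv ℝ f))) :=
          add_le_add h0 hIH
      _ ≤ (a * eContDiffHolderNorm (k + 1) r f + b * eContDiffHolderNorm (k + 1 + 2) r f) +
          (a * ((k + 3 : ℝ≥0∞) * eContDiffHolderNorm (k + 1) r f) +
            b * ((k + 3 : ℝ≥0∞) * eContDiffHolderNorm (k + 1 + 2) r f)) := by
          gcongr
      _ = a * ((↑(k + 1) + 3 : ℝ≥0∞) * eContDiffHolderNorm (k + 1) r f) +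
          b * ((↑(k + 1) + 3 : ℝ≥0∞) * eContDiffHolderNorm (k + 1 + 2) r f) := by
          push_cast
          ring

/-- **Three consecutive orders** (interpolation between `k + r` and `k + 2 + r`): for a
`C^{k+2}` map with `‖f‖_{k,r}`, `‖f‖_{k+2,r}` finite,
`‖f‖_{k+1,r}² ≤ 8 (k+3)² ‖f‖_{k,r} ‖f‖_{k+2,r}` (BDSV (A.4); Gilbarg–Trudinger Lemma 6.35).
[folklore] -/
theorem sq_eContDiffHolderNorm_succ_le (k : ℕ) {f : E' → Y} (hf : ContDiff ℝ (k + 2) f)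
    (r : ℝ≥0) (hk : eContDiffHolderNorm k r f ≠ ⊤) (hk2 : eContDiffHolderNorm (k + 2) r f ≠ ⊤) :
    eContDiffHolderNorm (k + 1) r f ^ 2 ≤
      8 * ((k + 3 : ℝ≥0∞) * eContDiffHolderNorm k r f) *
        ((k + 3 : ℝ≥0∞) * eContDiffHolderNorm (k + 2) r f) := by
  have hk3 : (k + 3 : ℝ≥0∞) ≠ ⊤ := by
    exact_mod_cast ENNReal.natCast_ne_top (k + 3)
  exact sq_le_of_forall_scale (ENNReal.mul_ne_top hk3 hk) (ENNReal.mul_ne_top hk3 hk2)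
    fun s hs => eContDiffHolderNorm_succ_le_scale k hf r hs

end ThreeOrders

/-! ## Discrete log-convexity -/

section Discrete

variable {a : ℕ → ℝ≥0∞} {Λ : ℝ≥0∞} {m : ℕ}

/-- Cancelling a finite factor: `P² ≤ K P` with `P < ∞` gives `P ≤ K`. [folklore] -/
theorem le_of_sq_le_mul_self {P K : ℝ≥0∞} (hP : P ≠ ⊤) (h : P ^ 2 ≤ K * P) : P ≤ K := by
  rcases eq_or_ne P 0 with rfl | h0
  · exact bot_le
  rw [sq] at h
  exact (ENNReal.mul_le_mul_iff_left h0 hP).1 h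

/-- **Outward shift.** For a finite sequence `a` with `a_{j+1}² ≤ Λ a_j a_{j+2}` (`j + 2 ≤ m`,
`Λ ≥ 1`): `a_{i+1} a_{i+1+g} ≤ Λ^{g+2} a_i a_{i+g+2}` whenever `i + g + 2 ≤ m` (induction on the
gap `g`, two steps at a time). [folklore] -/
theorem mul_le_pow_mul_of_sq_le (hΛ : 1 ≤ Λ) (hfin : ∀ j, a j ≠ ⊤)
    (hconv : ∀ j, j + 2 ≤ m → a (j + 1) ^ 2 ≤ Λ * a j * a (j + 2)) :
    ∀ g i, i + g + 2 ≤ m → a (i + 1) * a (i + 1 + g) ≤ Λ ^ (g + 2) * a i * a (i + g + 2) := by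
  intro g
  induction g using Nat.strong_induction_on with
  | _ g IH =>
    intro i hi
    have hP : a (i + 1) * a (i + 1 + g) ≠ ⊤ := ENNReal.mul_ne_top (hfin _) (hfin _)
    rcases Nat.lt_or_ge g 2 with hg | hg
    · interval_cases g
      · -- gap 0
        rw [add_zero, ← sq]
        calc a (i + 1) ^ 2 ≤ Λ * a i * a (i + 2) := hconv i (by omega)
          _ ≤ Λ ^ (0 + 2) * a i * a (i + 0 + 2) := by
              rw [zero_add, add_zero, sq]
              gcongr
              exact le_mul_of_one_le_left' hΛ
      · -- gap 1
        refine le_of_sq_le_mul_self hP ?_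
        have h1 := hconv i (by omega)
        have h2 := hconv (i + 1) (by omega)
        calc (a (i + 1) * a (i + 1 + 1)) ^ 2 = a (i + 1) ^ 2 * a (i + 1 + 1) ^ 2 := mul_pow _ _ 2
          _ ≤ (Λ * a i * a (i + 2)) * (Λ * a (i + 1) * a (i + 1 + 2)) := mul_le_mul' h1 h2
          _ = Λ ^ 2 * a i * a (i + 1 + 2) * (a (i + 1) * a (i + 1 + 1)) := by ring
          _ ≤ Λ ^ (1 + 2) * a i * a (i + 1 + 2) * (a (i + 1) * a (i + 1 + 1)) := by
              gcongr
              norm_num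
    · -- gap `g ≥ 2`: peel one layer and use the induction hypothesis at gap `g - 2`
      obtain ⟨g', rfl⟩ : ∃ g', g = g' + 2 := ⟨g - 2, by omega⟩
      refine le_of_sq_le_mul_self hP ?_
      have h1 := hconv i (by omega)
      have h2 := hconv (i + g' + 2) (by omega)
      have hinner := IH g' (by omega) (i + 1) (by omega)
      -- `a_{i+2} a_{i+2+g'} ≤ Λ^{g'+2} a_{i+1} a_{i+1+g'+2}`
      calc (a (i + 1) * a (i + 1 + (g' + 2))) ^ 2
          = a (i + 1) ^ 2 * a (i + g' + 2 + 1) ^ 2 := by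
            rw [mul_pow]; congr 2; ring_nf
        _ ≤ (Λ * a i * a (i + 2)) * (Λ * a (i + g' + 2) * a (i + g' + 2 + 2)) := mul_le_mul' h1 h2
        _ = Λ ^ 2 * a i * a (i + g' + 2 + 2) * (a (i + 1 + 1) * a (i + 1 + 1 + g')) := by
            ring_nf
        _ ≤ Λ ^ 2 * a i * a (i + g' + 2 + 2) *
              (Λ ^ (g' + 2) * a (i + 1) * a (i + 1 + g' + 2)) := mul_le_mul' le_rfl hinner
        _ = Λ ^ (g' + 2 + 2) * a i * a (i + (g' + 2) + 2) * (a (i + 1) * a (i + 1 + (g' + 2))) := by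
            ring_nf

/-- **Discrete log-convexity, product form.** Under the hypotheses of `mul_le_pow_mul_of_sq_le`,
moving both indices of a product `a_p a_q` outwards by `n` steps costs at most `Λ^{n(m+2)}`:
`a_{k+n} a_{k+n+g} ≤ Λ^{n(m+2)} a_k a_{k+2n+g}` for `k + 2n + g ≤ m`. [folklore] -/
theorem mul_le_pow_mul_of_sq_le_iterate (hΛ : 1 ≤ Λ) (hfin : ∀ j, a j ≠ ⊤)
    (hconv : ∀ j, j + 2 ≤ m → a (j + 1) ^ 2 ≤ Λ * a j * a (j + 2)) :
    ∀ n g k, k + 2 * n + g ≤ m →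
      a (k + n) * a (k + n + g) ≤ Λ ^ (n * (m + 2)) * a k * a (k + 2 * n + g) := by
  intro n
  induction n with
  | zero =>
    intro g k _
    simp
  | succ n IH =>
    intro g k hk
    have hstep := mul_le_pow_mul_of_sq_le hΛ hfin hconv g (k + n) (by omega)
    have hIH := IH (g + 2) k (by omega)
    have hpow : Λ ^ (g + 2) * Λ ^ (n * (m + 2)) ≤ Λ ^ ((n + 1) * (m + 2)) := by
      rw [← pow_add]
      exact pow_le_pow_right₀ hΛ (by nlinarith [show g ≤ m by omega])
    calc a (k + (n + 1)) * a (k + (n + 1) + g)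
        = a (k + n + 1) * a (k + n + 1 + g) := by ring_nf
      _ ≤ Λ ^ (g + 2) * a (k + n) * a (k + n + g + 2) := hstep
      _ = Λ ^ (g + 2) * (a (k + n) * a (k + n + (g + 2))) := by ring_nf
      _ ≤ Λ ^ (g + 2) * (Λ ^ (n * (m + 2)) * a k * a (k + 2 * n + (g + 2))) :=
          mul_le_mul' le_rfl hIH
      _ = (Λ ^ (g + 2) * Λ ^ (n * (m + 2))) * a k * a (k + 2 * (n + 1) + g) := by ring_nf
      _ ≤ Λ ^ ((n + 1) * (m + 2)) * a k * a (k + 2 * (n + 1) + g) := by gcongr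

end Discrete

/-! ## The torus: interpolation for smooth functions -/

namespace Torus

variable {d : Type u} [Fintype d] {Y : Type u} [NormedAddCommGroup Y] [NormedSpace ℝ Y]
variable {f : UnitAddTorus d → Y} {r : ℝ≥0}

/-- The base `8 (m+3)²` of the interpolation constants is at least `1`. [folklore] -/
theorem one_le_holderInterpBase (m : ℕ) : (1 : ℝ≥0∞) ≤ 8 * ((m : ℝ≥0∞) + 3) ^ 2 := by
  have h3 : (1 : ℝ≥0∞) ≤ (m : ℝ≥0∞) + 3 := le_add_self.trans' (by norm_num)
  calc (1 : ℝ≥0∞) = 1 * 1 ^ 2 := by norm_num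
    _ ≤ 8 * ((m : ℝ≥0∞) + 3) ^ 2 := by
        gcongr
        norm_num

/-- The (crude, explicit) constant `(8 (m+3)²)^{m(m+2)}` of the tame product inequality up to
order `m` is finite; only its independence of the function matters. [folklore] -/
theorem holderInterpConst_ne_top (m : ℕ) :
    ((8 * ((m : ℝ≥0∞) + 3) ^ 2) ^ (m * (m + 2)) : ℝ≥0∞) ≠ ⊤ := by
  have : (m : ℝ≥0∞) + 3 ≠ ⊤ := by
    exact ENNReal.add_ne_top.2 ⟨ENNReal.natCast_ne_top m, by norm_num⟩
  exact ENNReal.pow_ne_top (ENNReal.mul_ne_top (by norm_num) (ENNReal.pow_ne_top this))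

/-- **Three consecutive orders on the torus**: for smooth `f` on `T^d` and `r ≤ 1`,
`‖f‖_{k+1,r}² ≤ 8 (k+3)² ‖f‖_{k,r} ‖f‖_{k+2,r}` in the accepted norms `Torus.eContDiffHolderNorm`
(BDSV (A.4); Gilbarg–Trudinger Lemma 6.35). [cite: BuckmasterEtAl2018, App. A (A.1)-(A.4)] -/
theorem sq_eContDiffHolderNorm_succ_le (hf : IsSmooth f) (hr : r ≤ 1) (k : ℕ) :
    Torus.eContDiffHolderNorm (k + 1) r f ^ 2 ≤
      8 * ((k + 3 : ℝ≥0∞) * Torus.eContDiffHolderNorm k r f) *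
        ((k + 3 : ℝ≥0∞) * Torus.eContDiffHolderNorm (k + 2) r f) :=
  FunctionSpaces.sq_eContDiffHolderNorm_succ_le k
    (hf.isContDiff (by rw [← WithTop.coe_natCast]; exact WithTop.coe_le_coe.mpr le_top)) r
    (hf.eContDiffHolderNorm_lt_top k hr).ne (hf.eContDiffHolderNorm_lt_top (k + 2) hr).ne

/-- **Tame product inequality on the torus** (discrete log-convexity of `k ↦ ‖f‖_{k,r}`): for
smooth `f` on `T^d`, `r ≤ 1` and orders `k ≤ p ≤ q ≤ m` with `p + q = k + m`,
`‖f‖_{p,r} ‖f‖_{q,r} ≤ C(m) ‖f‖_{k,r} ‖f‖_{m,r}` with the explicit `C(m) = (8 (m+3)²)^{m(m+2)}`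
(BDSV (A.4): "the standard interpolation inequalities `[f]_s ≤ C‖f‖₀^{1-s/r}[f]_r^{s/r}`", in
product form). [cite: BuckmasterEtAl2018, App. A (A.4)] -/
theorem eContDiffHolderNorm_mul_le_of_add_eq (hf : IsSmooth f) (hr : r ≤ 1) {k p q m : ℕ}
    (hkp : k ≤ p) (hpq : p ≤ q) (hqm : q ≤ m) (hsum : p + q = k + m) :
    Torus.eContDiffHolderNorm p r f * Torus.eContDiffHolderNorm q r f ≤
      (8 * ((m : ℝ≥0∞) + 3) ^ 2) ^ (m * (m + 2)) *
        Torus.eContDiffHolderNorm k r f * Torus.eContDiffHolderNorm m r f := by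
  set a : ℕ → ℝ≥0∞ := fun j => Torus.eContDiffHolderNorm j r f with ha
  set Λ : ℝ≥0∞ := 8 * ((m : ℝ≥0∞) + 3) ^ 2 with hΛ
  have hΛ1 : 1 ≤ Λ := one_le_holderInterpBase m
  have hfin : ∀ j, a j ≠ ⊤ := fun j => (hf.eContDiffHolderNorm_lt_top j hr).ne
  have hconv : ∀ j, j + 2 ≤ m → a (j + 1) ^ 2 ≤ Λ * a j * a (j + 2) := by
    intro j hj
    refine (sq_eContDiffHolderNorm_succ_le hf hr j).trans ?_
    have hj3 : (j + 3 : ℝ≥0∞) ≤ (m : ℝ≥0∞) + 3 := by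
      gcongr
      exact_mod_cast (by omega : j ≤ m)
    calc 8 * ((j + 3 : ℝ≥0∞) * a j) * ((j + 3 : ℝ≥0∞) * a (j + 2))
        = 8 * (j + 3 : ℝ≥0∞) ^ 2 * a j * a (j + 2) := by ring
      _ ≤ 8 * ((m : ℝ≥0∞) + 3) ^ 2 * a j * a (j + 2) := by gcongr
  obtain ⟨n, rfl⟩ : ∃ n, p = k + n := ⟨p - k, by omega⟩
  obtain ⟨g, rfl⟩ : ∃ g, q = k + n + g := ⟨q - (k + n), by omega⟩
  have hm : k + 2 * n + g = m := by omega
  have key := mul_le_pow_mul_of_sq_le_iterate hΛ1 hfin hconv n g k hm.le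
  rw [hm] at key
  -- `Λ^{n(m+2)} ≤ Λ^{m(m+2)}`
  have hexp : Λ ^ (n * (m + 2)) ≤ Λ ^ (m * (m + 2)) :=
    pow_le_pow_right₀ hΛ1 (Nat.mul_le_mul_right _ (by omega))
  exact key.trans (mul_le_mul' (mul_le_mul' hexp le_rfl) le_rfl)

/-- **Tame pairs**: for smooth `f` on `T^d`, `r ≤ 1`, and orders `p, q ≥ 1` with
`p + q = m + 1`, `‖f‖_{p,r} ‖f‖_{q,r} ≤ C(m) ‖f‖_{1,r} ‖f‖_{m,r}`, `C(m) = (8 (m+3)²)^{m(m+2)}` — the form in which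
interpolation enters the higher-order energy estimates for the Euler equations (BDSV 2019, proof
of Prop. 3.1: `‖∇v·∇v‖_{N-1+α} ≲ ‖v‖_{1+α}‖v‖_{N+α}`). [cite: BuckmasterEtAl2018, App. A (A.4)] -/
theorem eContDiffHolderNorm_mul_le_tame (hf : IsSmooth f) (hr : r ≤ 1) {p q m : ℕ} (hp : 1 ≤ p)
    (hq : 1 ≤ q) (hsum : p + q = m + 1) :
    Torus.eContDiffHolderNorm p r f * Torus.eContDiffHolderNorm q r f ≤
      (8 * ((m : ℝ≥0∞) + 3) ^ 2) ^ (m * (m + 2)) *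
        Torus.eContDiffHolderNorm 1 r f * Torus.eContDiffHolderNorm m r f := by
  rcases le_total p q with hpq | hqp
  · exact eContDiffHolderNorm_mul_le_of_add_eq hf hr hp hpq (by omega) (by omega)
  · rw [mul_comm (Torus.eContDiffHolderNorm p r f)]
    exact eContDiffHolderNorm_mul_le_of_add_eq hf hr hq hqp (by omega) (by omega)

end Torus

end Literature.Analysis.FunctionSpaces
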